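import Summits.PneNP.PneNP.Theses.RootDecompMagnificationPayout
import Literature.Computability.MetaComplexity.MagnificationGapCensus
import Literature.Computability.MetaComplexity.FormulaModelsAE

/-!
# `RootDecompMagnificationPayout.WindowBelowThreshold` (stmt-PneNP-32099) — the window sits below the OPS threshold

Node N40 of the decomp-pnenp root-decomposition cell (route `route-PneNP-RootDecompMagnificationPayout`,
lens-1 g10 «MagnificationPayout», cut fixed at `q = 1`): the census row R3 of the magnification gap
census (`MagnificationGapCensus.gap_R3` = Oliveira–Pich–Santhanam's magnification hypothesis for every
`c ≥ 1`: `Gap-MCSP[2^{βn}/(cn), 2^{βn}] ∉ Circuit[N^{1+ε}]` for some `ε > 0` and all small `β > 0`) implies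
the window cell at `q = 1` (`Gap-MCSP ∉ Circuit[N·⌊log₂ N⌋ + 1]` a.e.), because the window bound is
eventually below every threshold `⌊N^{1+ε}⌋` — the cut sits BELOW the threshold.  Port of the lens
kernel `cell_of_gap_R3` / `windowLB_of_lowerBound` / `windowBound_eventually_le_sizeBound` (writer pack
`windowBelowThreshold_holds`), with the numeric separation proved for every `q`.  0 sorry.
[cite: OliveiraPichSanthanam2021, Thm. 1.4 (hypothesis)]
-/

namespace Summit.PneNP.PneNP.Theorems

open Filter Literature.Computability.Complexity Literature.Computability.MetaComplexity
open Literature.Computability.MetaComplexity.MagnificationGapCensus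

/-- Promise lifts are monotone in the class (port of the lens lemma `promiseLift_mono'`). -/
private theorem window_promiseLift_mono {C D : Set (Language Bool)} (h : C ⊆ D) :
    promiseLift C ⊆ promiseLift D :=
  fun _ ⟨L, hL, hy, hn⟩ => ⟨L, h hL, hy, hn⟩

/-- NUMERIC SEPARATION: the window bound `N·⌊log₂N⌋^q + q` is eventually below every threshold size
`⌊N^{1+ε}⌋`, `ε > 0` (port of the lens lemma `windowBound_eventually_le_sizeBound`). [folklore] -/
private theorem window_eventually_le_sizeBound (q : ℕ) {ε : ℝ} (hε : 0 < ε) :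
    ∃ n₁ : ℕ, ∀ N ≥ n₁, N * Nat.log 2 N ^ q + q ≤ OliveiraPichSanthanam2019.sizeBound ε N := by
  -- Step 1 (real asymptotics): eventually `(2 log x)^q + q ≤ x^ε`.
  have hev : ∀ᶠ x : ℝ in atTop, (2 * Real.log x) ^ q + q ≤ x ^ ε := by
    have h1 : (fun x : ℝ => Real.log x ^ (q : ℝ)) =o[atTop] fun x => x ^ ε :=
      isLittleO_log_rpow_rpow_atTop (q : ℝ) hε
    have h1' : ∀ᶠ x : ℝ in atTop, ‖Real.log x ^ (q : ℝ)‖ ≤ (1 / 2 ^ (q + 1)) * ‖x ^ ε‖ :=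
      h1.bound (by positivity)
    have h2' : ∀ᶠ x : ℝ in atTop, (2 * q : ℝ) ≤ x ^ ε :=
      (tendsto_rpow_atTop hε).eventually_ge_atTop _
    filter_upwards [h1', h2', eventually_ge_atTop (1 : ℝ)] with x hx hx2 hx1
    have hlog0 : 0 ≤ Real.log x := Real.log_nonneg hx1
    have hxε0 : 0 ≤ x ^ ε := Real.rpow_nonneg (by linarith) _
    rw [Real.norm_eq_abs, Real.norm_eq_abs, abs_of_nonneg (Real.rpow_nonneg hlog0 _),
      abs_of_nonneg hxε0, Real.rpow_natCast] at hx
    have h2q : (0 : ℝ) < 2 ^ (q + 1) := by positivity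
    calc (2 * Real.log x) ^ q + q = 2 ^ q * Real.log x ^ q + q := by rw [mul_pow]
      _ ≤ 2 ^ q * (1 / 2 ^ (q + 1) * x ^ ε) + x ^ ε / 2 := by gcongr; linarith
      _ = x ^ ε := by field_simp; ring
  -- Step 2: transfer to natural arguments and compare with `⌊N^{1+ε}⌋`.
  obtain ⟨n₁, hn₁⟩ := eventually_atTop.1 (tendsto_natCast_atTop_atTop.eventually hev)
  refine ⟨max n₁ 1, fun N hN => ?_⟩
  have hN1 : 1 ≤ N := le_of_max_le_right hN
  have hreal : (2 * Real.log (N : ℝ)) ^ q + q ≤ (N : ℝ) ^ ε := hn₁ N (le_of_max_le_left hN)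
  have hlog : (Nat.log 2 N : ℝ) ≤ 2 * Real.log (N : ℝ) := by
    have h2 : (2 : ℝ) ^ (Nat.log 2 N) ≤ N := by exact_mod_cast Nat.pow_log_le_self 2 (by omega)
    have hl := Real.log_le_log (by positivity) h2
    rw [Real.log_pow] at hl
    have hln2 : (1 : ℝ) / 2 ≤ Real.log 2 := by
      have := Real.log_two_gt_d9; norm_num at this ⊢; linarith
    have h0 : (0 : ℝ) ≤ Nat.log 2 N := Nat.cast_nonneg _
    nlinarith
  have hNr : (1 : ℝ) ≤ N := by exact_mod_cast hN1
  have hN0 : (0 : ℝ) < N := by linarith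
  have hpow : ((Nat.log 2 N : ℕ) : ℝ) ^ q ≤ (2 * Real.log (N : ℝ)) ^ q :=
    pow_le_pow_left₀ (Nat.cast_nonneg _) hlog q
  have hq0 : (0 : ℝ) ≤ (2 * Real.log (N : ℝ)) ^ q :=
    pow_nonneg (by nlinarith [Real.log_nonneg hNr]) q
  unfold OliveiraPichSanthanam2019.sizeBound
  apply Nat.le_floor
  push_cast
  calc (N : ℝ) * (Nat.log 2 N : ℝ) ^ q + q ≤ N * ((2 * Real.log (N : ℝ)) ^ q + q) := by
        nlinarith [hpow, hq0, (Nat.cast_nonneg q : (0 : ℝ) ≤ q)]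
    _ ≤ N * (N : ℝ) ^ ε := by gcongr
    _ = (N : ℝ) ^ (1 + ε) := by rw [Real.rpow_add hN0, Real.rpow_one]

/-- The window at `q = 1` sits BELOW the OPS threshold (stmt-PneNP-32099, `WindowBelowThreshold`):
`gap_R3 → ∀ c ≥ 1, ∃ β₀ > 0, ∀ 0 < β < β₀, Gap-MCSP[2^{βn}/(cn), 2^{βn}] ∉ promiseLift (SIZEae (N·⌊log₂N⌋ + 1))`
— every instance of OPS's hypothesis at size `⌊N^{1+ε}⌋` transfers down to the window by monotonicity of
`SIZEae` and the numeric separation.  Port of the lens-1 g10 kernel `cell_of_gap_R3` (decomp-pnenp cell,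
2026-08-30). [cite: OliveiraPichSanthanam2021, Thm. 1.4 (hypothesis)] -/
theorem windowBelowThreshold_proof :
    Summit.PneNP.PneNP.Theses.RootDecompMagnificationPayout.WindowBelowThreshold := by
  unfold Summit.PneNP.PneNP.Theses.RootDecompMagnificationPayout.WindowBelowThreshold
  intro h c hc
  obtain ⟨ε, hε, β₀, hβ₀, hβ⟩ := h c hc
  refine ⟨β₀, hβ₀, fun β hb hb' hmem => hβ β hb hb' ?_⟩
  exact window_promiseLift_mono (SIZEae_mono (window_eventually_le_sizeBound 1 hε)) hmem

end Summit.PneNP.PneNP.Theorems
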